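import Mathlib
import Summits.Ventures.Crystal3D.Theorems.StickyWulffConstantTextureLiminfTexShadowDefs
import HarnessLib

/-!
# Line `TexShadow` (crux `TextureLiminf`, stmt-Ventures-19483) — definitions of the RUNGS file

HONEST FRAMING. Part of the venture `Summits/Ventures/Crystal3D` (cell `crystal3d-full`), route
`route-Ventures-StickyWulffConstant`, crux `TextureLiminf` (stmt-Ventures-19483).  The planner's rungs
file `HOME/cf-p1/route/lines/tex/TexShadowRungs.lean` (cf-p1 gen 16; evidence on stmt-Ventures-19483;
targets `rung_perBox`, `rung_perTwoBoxes` under `stub_polytopeCalculus`) states its targets in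
`namespace …TexShadow.Rungs` over the route spelling of the anisotropic perimeter (`perK`, `per`,
`supportFn` — identical to the declarations of `Theorems/StickyWulffConstantTextureLiminfTexShadowDefs.lean`,
which this namespace sees through its parent `…TexShadow`) and two further definitions, carried here
VERBATIM: the open axis-parallel box `box a b` and the coordinate unit vectors `e t`.
WHAT THIS IS NOT: a proof of the rungs (that is `Theorems/StickyWulffConstantTextureLiminfRungPerBox.lean`);
rung F-C1 not moved.
-/

noncomputable section

open scoped BigOperators InnerProductSpace ENNReal
open MeasureTheory

namespace Summit.Ventures.Crystal3D.Cruxes.TextureLiminf.TexShadow.Rungs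

/-- the open axis-parallel box `Π_t (a_t, b_t)`. -/
def box (a b : E3) : Set E3 := {x | ∀ t : Fin 3, a t < x t ∧ x t < b t}

/-- coordinate unit vector -/
noncomputable def e (t : Fin 3) : E3 := EuclideanSpace.single t (1 : ℝ)

end Summit.Ventures.Crystal3D.Cruxes.TextureLiminf.TexShadow.Rungs

end
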